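import Summits.CriticalPhenomena.SAWScalingLimit.Theses.SAWTrackTransport
import Summits.CriticalPhenomena.SAWScalingLimit.Theses.SAWCompassLattice
import Summits.CriticalPhenomena.SAWScalingLimit.Theses.SAWLoopFugacityFlow
import Summits.CriticalPhenomena.SAWScalingLimit.Theses.SAWHexUniversality
import Summits.CriticalPhenomena.SAWScalingLimit.Theses.SAWParafermion
import Literature.Probability.RandomPlanarGeometry.PortGadgetLattice

/-!
# Sketch — typed first lemmas quoted in `Cruxes/YBtoUniform/STRATEGY-CENSUS.md`
(crux-strategist planner-cstrat-stmt-CriticalPhenomena-16966-b1-0; statements only, no proofs claimed)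

Every `def … : Prop` below elaborates over tree declarations; they are the signatures the census
refers to under Decomposition D-C (restriction cut) and Transfer T5 (toll at `π/3`).
-/

noncomputable section

namespace Summit.CriticalPhenomena.SAWScalingLimit.Cruxes.YBtoUniform.StrategistSketch

open MeasureTheory Filter Topology Set
open scoped NNReal ENNReal
open Literature.Probability.RandomPlanarGeometry
open Literature.Probability.RandomPlanarGeometry.SAW
open Literature.Probability.RandomPlanarGeometry.SAW.YangBaxter
open Literature.Probability.LatticeModels (Site HexVertex hexGraph hexCenter)
open Summit.CriticalPhenomena.SAWScalingLimit.Theses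

/-- The square tiling. -/
abbrev rightAngles : ℤ → ℝ := fun _ => Real.pi / 2

/-- **D-C, scalar kernel `RestrictionToll`**: the critical `δℤ²` SAW and GM's critical square-tiling
Yang–Baxter walk give asymptotically equal mass to every HULL-AVOIDANCE event
`{range ⊆ closure D'}` (`D'` an inline hull subdomain of `D`: same marked points, agreeing with `D`
near them) — the restriction-probability form of the toll (ratios of partition functions
`Z(Ω'_δ; a, b) / Z(Ω_δ; a, b)` on both sides, up to boundary-touching walks). [folklore] -/
def RestrictionToll : Prop :=
  ∀ (D D' : DobrushinDomain) (a b : ℝ → Site 2) (a' b' : ℝ → MidEdge),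
    SAW.IsEndpointApprox D a b → IsYBEndpointApprox rightAngles D a' b' →
    D'.carrier ⊆ D.carrier → D'.pt 0 = D.pt 0 → D'.pt 1 = D.pt 1 →
    (∃ ε : ℝ, 0 < ε ∧ D'.carrier ∩ Metric.ball (D.pt 0) ε = D.carrier ∩ Metric.ball (D.pt 0) ε ∧
      D'.carrier ∩ Metric.ball (D.pt 1) ε = D.carrier ∩ Metric.ball (D.pt 1) ε) →
    Tendsto (fun δ : ℝ =>
        ((SAW.law D.carrier δ (a δ) (b δ)).map (fun γ => γ.curve)).real
            (CurveClass.rangeSubset (closure D'.carrier)) -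
          ((ybLaw rightAngles D.carrier δ 1 (a' δ) (b' δ)).map
              (fun γ => γ.curve rightAngles δ)).real
            (CurveClass.rangeSubset (closure D'.carrier)))
      (𝓝[>] (0 : ℝ)) (𝓝 0)

/-- **D-C, the YB-side inputs the restriction cut needs besides the scalar kernel**: eventual
tightness and simple boundary-avoiding subsequential limits of the Yang–Baxter curve laws (the YB
analogues of items stmt-1881 `EventualTight` and stmt-4982 `SimpleSubseqLimits`). [folklore] -/
def YBTightSimple : Prop :=
  ∀ (D : DobrushinDomain) (a' b' : ℝ → MidEdge), IsYBEndpointApprox rightAngles D a' b' →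
    IsTightAlongMesh (fun δ (γ : YangBaxterSAW rightAngles D.carrier δ (a' δ) (b' δ)) =>
        γ.curve rightAngles δ) (fun δ => ybLaw rightAngles D.carrier δ 1 (a' δ) (b' δ)) ∧
    ∀ (s : ℕ → ℝ) (ν : Measure (CurveClass ℂ)), Tendsto s atTop (𝓝[>] (0 : ℝ)) →
      IsProbabilityMeasure ν →
      (∀ f : BoundedContinuousFunction (CurveClass ℂ) ℝ,
        Tendsto (fun n => ∫ γ, f (γ.curve rightAngles (s n))
          ∂(ybLaw rightAngles D.carrier (s n) 1 (a' (s n)) (b' (s n)))) atTop (𝓝 (∫ x, f x ∂ν))) →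
      ∀ᵐ γ ∂ν, γ ∈ CurveClass.simple ∧ γ.source = D.pt 0 ∧ γ.target = D.pt 1 ∧
        γ.range ⊆ closure D.carrier ∧ γ.range ∩ frontier D.carrier ⊆ {D.pt 0, D.pt 1}

/-- **D-C, the composition the restriction cut would have to prove** (shape only; the existing PROVED
item `SAWLoopFugacityFlow.AvoidanceDeterminesLaw` (stmt-1373) is the determination lemma, the open
items `SAWParafermion.EventualTight` (stmt-1881) and `SAWLoopFugacityFlow.SimpleSubseqLimits`
(stmt-4982) are the `ℤ²`-side inputs; a no-atom/continuity clause for the limit avoidance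
probabilities is hidden in the portmanteau step and would surface as a further stub). [folklore] -/
def RestrictionCut : Prop :=
  SAWLoopFugacityFlow.AvoidanceDeterminesLaw → SAWParafermion.EventualTight →
    SAWLoopFugacityFlow.SimpleSubseqLimits → YBTightSimple → RestrictionToll →
    SAWTrackTransport.YBtoUniform

/-- **T5, the hex leg the `π/3` transfer would add** (conventions only, hex-only, open): the critical
hexagonal SAW law in DCS conventions (`hexSAWLaw` on `embMeshDomain hexGraph hexCenter`, vertex
endpoints, `IsEmbEndpointApprox`) and GM's `Θ ≡ π/3` Yang–Baxter law of the QUARTER-TURNED domain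
(GM's honeycomb is `hexCenter`'s turned by `90°` and shifted by half a period; cf. the landed exact
dictionary `GMHexDictionary`, p142516) merge on bounded continuous test functions after turning the
curves back. [cite: GlazmanManolescu2019, §1 p. 3 and Fig. 2] -/
def HexConventionsLeg : Prop :=
  ∀ (D : DobrushinDomain) (a b : ℝ → HexVertex) (a' b' : ℝ → MidEdge),
    SAW.IsEmbEndpointApprox hexGraph hexCenter D a b →
    IsYBEndpointApprox (fun (_ : ℤ) => Real.pi / 3)
      (D.map (similarity Complex.I Complex.I_ne_zero 0)) a' b' →
    ∀ f : BoundedContinuousFunction (CurveClass ℂ) ℝ,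
      Tendsto (fun δ : ℝ =>
          (∫ γ, f γ.curve ∂(SAW.hexSAWLaw D.carrier δ (a δ) (b δ))) -
            ∫ γ, f (CurveClass.map (similarity Complex.I Complex.I_ne_zero 0).symm
                (γ.curve (fun (_ : ℤ) => Real.pi / 3) δ))
              ∂(ybLaw (fun (_ : ℤ) => Real.pi / 3)
                  (D.map (similarity Complex.I Complex.I_ne_zero 0)).carrier δ 1 (a' δ) (b' δ)))
        (𝓝[>] (0 : ℝ)) (𝓝 0)

/-- **T5, the shape of the `π/3` transfer of the toll** (not registered: it lands the kernel on the
open item `SAWHexUniversality.LatticeUniversality`, stmt-0807, which has no mechanism either, and the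
live HexTransfer line `yb_relay` already routes stmt-0807-under-(A) back through this very toll).
The remaining inputs — law-level angle transport `π/3 ↔ π/2` in the turned domain (⇐ stmt-16995 ∧
stmt-16963, landed `angleTransport_of_trackTransport` p138469), `π/3` endpoint approximations, and
the exact quarter-turn covariance of `SAW.law` — are spelled in the census, not here. [folklore] -/
def ThirdTransferShape : Prop :=
  SAWHexUniversality.LatticeUniversality → HexConventionsLeg → SAWTrackTransport.YBLimitExists →
    SAWTrackTransport.AngleUniversality → SAWTrackTransport.YBtoUniform

end Summit.CriticalPhenomena.SAWScalingLimit.Cruxes.YBtoUniform.StrategistSketch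

end
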